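import Literature.Geometry.Lorentzian.CoordMomentumJet
import Literature.Geometry.Lorentzian.KerrCylinderSecondOrder
import HarnessLib

/-!
# The uniform second-order Taylor remainder of the momentum constraint

Generic coordinate calculus (`MetricCoord`), continuing `CoordMomentumJet.lean`, in support of
the nonlinear remainder estimate in Step S5 of Li–Mei's interior Kerr gluing
(`InteriorKerrGluingReduction.lean`; J. Li, H. Mei, arXiv:2005.01249, Prop. 4.1, p. 25:
`𝓘 = L p + e + O(ε²)`). With `M = momOf ∘ jets` (`IsMetricOn.momFn_eq_momOf`), `momOf` smooth
(`contDiffAt_momOf₂`) and `D(momOf)(jets) = DM` (`IsMetricOn.fderiv_momOf_jetAt`), the uniform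
parametric Taylor estimate `exists_norm_taylor₂_le_parametric` (`KerrCylinderSecondOrder.lean`)
gives:

* `IsMetricOn.exists_invertible_of_norm_le` — a uniform invertibility margin `r > 0` for
  `G₀(y) + A`, `‖A‖ ≤ r`, `y` in a compact subset `L` of the domain;
* **`IsMetricOn.exists_abs_momOf_taylor₂_le`** — `∃ r C`, for `y ∈ L`, `‖Z‖ ≤ 1`, `‖ΔJ‖ ≤ r`:
  `|momOf(J₀(y) + ΔJ) − momOf(J₀(y)) − D momOf(J₀(y)) ΔJ| ≤ C ‖ΔJ‖²`;
* **`IsMetricOn.exists_abs_momFn_sub_linMomFn_le`** — the field form: for smooth symmetric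
  `(γ, κ)` on the domain with `‖J(γ,κ)(y)‖ ≤ r`,
  `|M(G₀ + γ, K₀ + κ)(y)(Z) − M(G₀, K₀)(y)(Z) − DM_{(G₀,K₀)}(γ, κ)(y)(Z)| ≤ C ‖J(γ,κ)(y)‖²`,
  `J(γ,κ)(y) = (γ(y), Dγ(y), κ(y), Dκ(y))` — **the quadratic remainder of the momentum constraint is
  controlled by the first jets of the perturbation, uniformly on compact sets.**

Everything is folklore calculus; no named facts.

## References

* J. Li, H. Mei, arXiv:2005.01249, §4, proof of Prop. 4.1, p. 25. [LiMei2020]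
* R. Bartnik, J. Isenberg, *The constraint equations*, Birkhäuser 2004, §2, (2.2).
  [BartnikIsenberg2004]
-/

noncomputable section

set_option maxSynthPendingDepth 3

open Set Filter ContinuousLinearMap Module Metric
open scoped Topology ContDiff

namespace Literature.Geometry.Lorentzian

namespace MetricCoord

variable {E : Type*} [NormedAddCommGroup E] [NormedSpace ℝ E] [CompleteSpace E]
  {ι : Type*} [Fintype ι] [FiniteDimensional ℝ E] (b : Basis ι ℝ E)
  {G₀ K₀ : E → E →L[ℝ] E →L[ℝ] ℝ} {V : Set E}

omit [FiniteDimensional ℝ E] in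
/-- **A uniform invertibility margin on compact sets**: for `L ⊆ V` compact there is `r > 0` with
`G₀(y) + A` invertible for all `y ∈ L`, `‖A‖ ≤ r`. [folklore] -/
theorem IsMetricOn.exists_invertible_of_norm_le (hG : IsMetricOn G₀ V) {L : Set E}
    (hL : IsCompact L) (hLV : L ⊆ V) :
    ∃ r : ℝ, 0 < r ∧ ∀ y ∈ L, ∀ A : E →L[ℝ] E →L[ℝ] ℝ, ‖A‖ ≤ r → (G₀ y + A).IsInvertible := by
  have hO : IsOpen (range ((↑) : (E ≃L[ℝ] (E →L[ℝ] ℝ)) → E →L[ℝ] E →L[ℝ] ℝ)) :=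
    ContinuousLinearEquiv.isOpen
  have hC : IsCompact (G₀ '' L) := hL.image_of_continuousOn (hG.contDiffOn.continuousOn.mono hLV)
  have hCO : G₀ '' L ⊆ range ((↑) : (E ≃L[ℝ] (E →L[ℝ] ℝ)) → E →L[ℝ] E →L[ℝ] ℝ) := by
    rintro _ ⟨y, hy, rfl⟩
    exact hG.isInvertible y (hLV hy)
  obtain ⟨δ, hδ, hδO⟩ := hC.exists_cthickening_subset_open hO hCO
  refine ⟨δ, hδ, fun y hy A hA ↦ ?_⟩
  have hmem : G₀ y + A ∈ cthickening δ (G₀ '' L) := by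
    refine mem_cthickening_of_dist_le _ (G₀ y) _ _ (mem_image_of_mem _ hy) ?_
    rwa [dist_eq_norm, add_sub_cancel_left]
  exact hδO hmem

/-- **Uniform second-order Taylor remainder of the jet function of the momentum constraint**:
for `L ⊆ V` compact there are `r > 0`, `C ≥ 0` with
`|momOf(J₀(y) + ΔJ) − momOf(J₀(y)) − D momOf(J₀(y)) ΔJ| ≤ C ‖ΔJ‖²` for all `y ∈ L`, `‖Z‖ ≤ 1`,
`‖ΔJ‖ ≤ r` (`J₀ = jetAt G₀ K₀`), and `G₀(y) + A` invertible for `‖A‖ ≤ r`.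
[cite: LiMei2020, proof of Prop. 4.1, p. 25] -/
theorem IsMetricOn.exists_abs_momOf_taylor₂_le (hG : IsMetricOn G₀ V) (hK : ContDiffOn ℝ ∞ K₀ V)
    {L : Set E} (hL : IsCompact L) (hLV : L ⊆ V) :
    ∃ r C : ℝ, 0 < r ∧ 0 ≤ C ∧
      (∀ y ∈ L, ∀ A : E →L[ℝ] E →L[ℝ] ℝ, ‖A‖ ≤ r → (G₀ y + A).IsInvertible) ∧
      ∀ y ∈ L, ∀ Z : E, ‖Z‖ ≤ 1 → ∀ ΔJ : Jet E, ‖ΔJ‖ ≤ r →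
        |momOf b Z (jetAt G₀ K₀ y + ΔJ) - momOf b Z (jetAt G₀ K₀ y) -
            fderiv ℝ (momOf b Z) (jetAt G₀ K₀ y) ΔJ| ≤ C * ‖ΔJ‖ ^ 2 := by
  obtain ⟨r, hr, hinv⟩ := hG.exists_invertible_of_norm_le hL hLV
  -- the parametric function and its domain
  set Φ : Jet E × (E × E) → ℝ := fun q ↦ momOf b q.2.2 (jetAt G₀ K₀ q.2.1 + q.1) with hΦ_def
  set U : Set (Jet E × (E × E)) := {q | q.2.1 ∈ V} ∩
    (fun q ↦ G₀ q.2.1 + q.1.1) ⁻¹' range ((↑) : (E ≃L[ℝ] (E →L[ℝ] ℝ)) → E →L[ℝ] E →L[ℝ] ℝ)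
    with hU_def
  have hπ : Continuous fun q : Jet E × (E × E) ↦ q.2.1 := continuous_fst.comp continuous_snd
  have hUo : IsOpen U := by
    refine ContinuousOn.isOpen_inter_preimage ?_ (hG.isOpen.preimage hπ) ContinuousLinearEquiv.isOpen
    exact (hG.contDiffOn.continuousOn.comp hπ.continuousOn fun q hq ↦ hq).add
      (continuous_fst.comp continuous_fst).continuousOn
  -- smoothness of `Φ` on `U`
  have hjet : ContDiffOn ℝ ∞ (jetAt G₀ K₀) V := hG.contDiffOn.jetAt hG.isOpen hK
  have hinner : ContDiffOn ℝ ∞ (fun q : Jet E × (E × E) ↦ (q.2.2, jetAt G₀ K₀ q.2.1 + q.1)) U :=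
    (contDiff_snd.comp contDiff_snd).contDiffOn.prodMk
      ((hjet.comp (contDiff_fst.comp contDiff_snd).contDiffOn (fun q hq ↦ hq.1)).add
        contDiff_fst.contDiffOn)
  have hΦi : ContDiffOn ℝ ∞ Φ U := by
    intro q hq
    have hq2 : (q.2.2, jetAt G₀ K₀ q.2.1 + q.1).2.1.IsInvertible := by
      obtain ⟨e, he⟩ := hq.2
      exact ⟨e, he⟩
    exact ((contDiffAt_momOf₂ b hq2).comp_contDiffWithinAt q (hinner q hq) :)
  have hΦs : ContDiffOn ℝ 2 Φ U := hΦi.of_le (by norm_cast)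
  -- the compact sets
  haveI : ProperSpace (Jet E) := FiniteDimensional.proper ℝ (Jet E)
  have hKc : IsCompact (closedBall (0 : Jet E) r) := isCompact_closedBall 0 r
  have hL' : IsCompact (L ×ˢ closedBall (0 : E) 1) := hL.prod (isCompact_closedBall 0 1)
  have hKL : closedBall (0 : Jet E) r ×ˢ (L ×ˢ closedBall (0 : E) 1) ⊆ U := by
    rintro ⟨ΔJ, y, Z⟩ ⟨hΔ, hy, -⟩
    refine ⟨hLV hy, ?_⟩
    have hn : ‖ΔJ.1‖ ≤ r := (norm_fst_le ΔJ).trans (mem_closedBall_zero_iff.1 hΔ)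
    obtain ⟨e, he⟩ := hinv y hy ΔJ.1 hn
    exact ⟨e, he⟩
  obtain ⟨C, hC0, hC⟩ := exists_norm_taylor₂_le_parametric hUo hΦs hKc (convex_closedBall 0 r)
    hL' hKL
  refine ⟨r, C, hr, hC0, hinv, fun y hy Z hZ ΔJ hΔJ ↦ ?_⟩
  have h0 : (0 : Jet E) ∈ closedBall (0 : Jet E) r := mem_closedBall_self hr.le
  have h := hC 0 h0 ΔJ (mem_closedBall_zero_iff.2 hΔJ) (y, Z) ⟨hy, mem_closedBall_zero_iff.2 hZ⟩
  simp only [hΦ_def, sub_zero, add_zero, Real.norm_eq_abs] at h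
  rwa [fderiv_comp_add_left, add_zero] at h

/-- **The quadratic remainder of the momentum constraint is controlled by the first jets of the
perturbation, uniformly on compact sets.** For `L ⊆ V` compact there are `r > 0`, `C ≥ 0` such
that for all smooth `(γ, κ)` on `V` with `γ` symmetric, all `y ∈ L` with `‖J(γ,κ)(y)‖ ≤ r` and
all `‖Z‖ ≤ 1`:
`|M(G₀+γ, K₀+κ)(y)(Z) − M(G₀,K₀)(y)(Z) − DM_{(G₀,K₀)}(γ,κ)(y)(Z)| ≤ C ‖J(γ,κ)(y)‖²`.
[cite: LiMei2020, proof of Prop. 4.1, p. 25] -/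
theorem IsMetricOn.exists_abs_momFn_sub_linMomFn_le (hG : IsMetricOn G₀ V)
    (hK : ContDiffOn ℝ ∞ K₀ V) {L : Set E} (hL : IsCompact L) (hLV : L ⊆ V) :
    ∃ r C : ℝ, 0 < r ∧ 0 ≤ C ∧ ∀ γ κ : E → E →L[ℝ] E →L[ℝ] ℝ,
      ContDiffOn ℝ ∞ γ V → (∀ y ∈ V, ∀ v w, γ y v w = γ y w v) → ContDiffOn ℝ ∞ κ V →
      ∀ y ∈ L, ‖jetAt γ κ y‖ ≤ r → ∀ Z : E, ‖Z‖ ≤ 1 →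
        |momFn b (G₀ + γ) (K₀ + κ) y Z - momFn b G₀ K₀ y Z - linMomFn b G₀ K₀ γ κ y Z| ≤
          C * ‖jetAt γ κ y‖ ^ 2 := by
  obtain ⟨r, C, hr, hC0, hinv, hT⟩ := hG.exists_abs_momOf_taylor₂_le b hK hL hLV
  refine ⟨r, C, hr, hC0, fun γ κ hγ hγs hκ y hy hjet Z hZ ↦ ?_⟩
  -- `G₀ + γ` is a metric on an open neighbourhood of `y`
  set V' : Set E := V ∩ (fun z ↦ G₀ z + γ z) ⁻¹'
    range ((↑) : (E ≃L[ℝ] (E →L[ℝ] ℝ)) → E →L[ℝ] E →L[ℝ] ℝ) with hV'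
  have hV'o : IsOpen V' :=
    ContinuousOn.isOpen_inter_preimage (hG.contDiffOn.continuousOn.add hγ.continuousOn) hG.isOpen
      ContinuousLinearEquiv.isOpen
  have hV'V : V' ⊆ V := inter_subset_left
  have hG' : IsMetricOn (G₀ + γ) V' := by
    refine ⟨hV'o, (hG.contDiffOn.add hγ).mono hV'V, fun z hz v w ↦ ?_, fun z hz ↦ ?_⟩
    · change G₀ z v w + γ z v w = G₀ z w v + γ z w v
      rw [hG.symm z (hV'V hz) v w, hγs z (hV'V hz) v w]
    · obtain ⟨e, he⟩ := hz.2
      exact ⟨e, he⟩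
  have hyV : y ∈ V := hLV hy
  have hyV' : y ∈ V' := by
    refine ⟨hyV, ?_⟩
    have hn : ‖γ y‖ ≤ r := (norm_fst_le (jetAt γ κ y)).trans hjet
    obtain ⟨e, he⟩ := hinv y hy (γ y) hn
    exact ⟨e, he⟩
  -- differentiability at `y`
  have hyn : V ∈ 𝓝 y := hG.isOpen.mem_nhds hyV
  have hdG : DifferentiableAt ℝ G₀ y := (hG.contDiffOn.contDiffAt hyn).differentiableAt (by simp)
  have hdK : DifferentiableAt ℝ K₀ y := (hK.contDiffAt hyn).differentiableAt (by simp)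
  have hdγ : DifferentiableAt ℝ γ y := (hγ.contDiffAt hyn).differentiableAt (by simp)
  have hdκ : DifferentiableAt ℝ κ y := (hκ.contDiffAt hyn).differentiableAt (by simp)
  rw [hG'.momFn_eq_momOf b hyV' (hdK.add hdκ) Z, hG.momFn_eq_momOf b hyV hdK Z,
    jetAt_add hdG hdγ hdK hdκ, ← hG.fderiv_momOf_jetAt b hK hγ hγs hκ hyV Z]
  exact hT y hy Z hZ _ hjet

end MetricCoord

end Literature.Geometry.Lorentzian

end
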